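import Mathlib
import Summits.NavierStokesRegularity.NavierStokesRegularity.Theorems.WakeRatchetTailRatchetQuietPastUniform
import HarnessLib

/-!
# `WakeRatchet.TailRatchet` (stmt-NavierStokesRegularity-21808) — hypothesis class of the tail ratchets:
# the loud shells of the far past are NOT CONFINED TO ANY FINITE BAND (any `ν̂ ≥ 0`; uses the action clause)

Support file (route `WakeRatchet`; MODEL lattice ODEs of Tao 2016 §4 / §6.4 — nothing here concerns the Navier–Stokes
equations; no item is closed).  Seventh file of the `WakeRatchetQuietPast` series (companion of `…QuietPastViscousLine`,
which shows that for `ν̂ > 0` the loud shells drift to `−∞`; here, for ANY `ν̂ ≥ 0` including the inviscid class of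
`stub_inviscid` / stmt-25646, the weaker two-sided statement from the ACTION clause alone).

* `measure_loud_lt_top` — for an admissible eternal solution and a finite band of shells `|k| ≤ N`, the set of log-times
  at which the band carries amplitude `≥ δ` (in the sense `Σ_{|k|≤N} ‖W_k(σ)‖ ≥ δ`) has finite Lebesgue measure
  (`Σ_{|k| ≤ N} ‖W_k‖` is integrable);
* `loud_outside_band` — hence a NON-TRIVIAL uniformly bounded admissible eternal solution of ANY table with ANY `ν̂ ≥ 0`
  has, for every `N` and before every `σ⋆`, a log-time `σ ≤ σ⋆` and a shell `k` with `|k| > N` and `‖W_k(σ)‖ > 1/(64K)`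
  (uniform backward floor `uniformly_loud_past` + the previous bullet): the far-past activity visits arbitrarily remote shells.

HONEST FRAMING: elementary; no stub, crux, rung or summit is proved (stmt-21808 stays dead modulo the construction
`WakeRatchetDyadicFront.DyadicScalarFronts`).
-/

noncomputable section

set_option linter.dupNamespace false

namespace Summit.NavierStokesRegularity.NavierStokesRegularity.Theorems

namespace WakeRatchetQuietPast

open Set Filter Topology MeasureTheory
open Literature.Analysis.FluidPDE Literature.Analysis.FluidPDE.TaoCascade

variable {m : ℕ} {ε₀ νh : ℝ} {α : Fin m → Fin m → Fin m → ℤ × ℤ × ℤ → ℝ} {W : ℤ → ℝ → Em m}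

/-- **A finite band of shells is loud only on a set of log-times of finite measure.**  For an admissible eternal
solution (action clause: every `‖W_k‖` integrable in log-time) and `δ > 0`, the set
`{σ | δ ≤ Σ_{k ∈ [-N, N]} ‖W_k(σ)‖}` has finite Lebesgue measure.
[cite: Tao2016AveragedNS, §4 Lemma 4.1 (4.8)–(4.10) (the action clause of the cell's `IsEternalVisc`); cell lemma] -/
theorem measure_loud_lt_top (hW : IsEternalVisc ε₀ νh α W) (N : ℕ) {δ : ℝ} (hδ : 0 < δ) :
    volume {σ : ℝ | δ ≤ ∑ k ∈ Finset.Icc (-(N : ℤ)) N, ‖W k σ‖} < ⊤ := by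
  obtain ⟨M, hM⟩ := hW.action
  have hint : Integrable (fun σ : ℝ => ∑ k ∈ Finset.Icc (-(N : ℤ)) N, ‖W k σ‖) :=
    integrable_finsetSum _ fun k _ => (hM k).1
  have h := hint.measure_norm_ge_lt_top hδ
  refine lt_of_le_of_lt (measure_mono fun σ hσ => ?_) h
  simp only [mem_setOf_eq] at hσ ⊢
  rw [Real.norm_of_nonneg (Finset.sum_nonneg fun k _ => norm_nonneg _)]
  exact hσ

/-- **Loud shells outside every finite band.**  A non-trivial uniformly bounded admissible eternal solution of ANY table
with ANY covariant viscosity `ν̂ ≥ 0` (`K > 0` a bound of the table constant) has, for every `N : ℕ` and every `σ⋆`, a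
log-time `σ ≤ σ⋆` and a shell `k` with `N < |k|` and `‖W_k(σ)‖ > 1/(64K)`: the far-past loud activity is not confined to
any finite band of shells.  (For `ν̂ > 0` the companion `loud_shells_below` gives the one-sided drift to `−∞`.)
[cite: Tao2016AveragedNS, §4 Lemma 4.1 (4.8)–(4.10), §6.4; cell theorem] -/
theorem loud_outside_band (hε : -1 < ε₀) (hW : IsEternalVisc ε₀ νh α W) (hU : UniformBound W) {K : ℝ}
    (hK : shiftConst α (0, 0, 0) + bigLam ε₀ * shiftConst α (0, 0, 1)
      + (bigLam ε₀)⁻¹ * (shiftConst α (1, 0, 0) + shiftConst α (0, 1, 0)) ≤ K)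
    (hK0 : 0 < K) (hne : ∃ (n : ℤ) (σ : ℝ), W n σ ≠ 0) (N : ℕ) (σs : ℝ) :
    ∃ (σ : ℝ) (k : ℤ), σ ≤ σs ∧ (N : ℤ) < |k| ∧ 1 / (64 * K) < ‖W k σ‖ := by
  obtain ⟨σ₀, hloud⟩ := uniformly_loud_past hε hW hU hK hK0 hne
  by_contra h
  push Not at h
  -- then before `s₀ := min σ₀ σ⋆` the loud shell always lies in the band `|k| ≤ N`
  set s₀ : ℝ := min σ₀ σs with hs₀
  have hδ : (0 : ℝ) < 1 / (64 * K) := by positivity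
  have hband : ∀ σ : ℝ, σ ≤ s₀ → 1 / (64 * K) ≤ ∑ k ∈ Finset.Icc (-(N : ℤ)) N, ‖W k σ‖ := by
    intro σ hσ
    obtain ⟨k, hk⟩ := hloud σ (hσ.trans (min_le_left _ _))
    have hkN : |k| ≤ N := by
      by_contra hgt
      push Not at hgt
      have := h σ k (hσ.trans (min_le_right _ _)) hgt
      linarith
    have hmem : k ∈ Finset.Icc (-(N : ℤ)) N := by
      rw [Finset.mem_Icc]; constructor <;> linarith [abs_le.1 hkN |>.1, abs_le.1 hkN |>.2]
    have hle : ‖W k σ‖ ≤ ∑ j ∈ Finset.Icc (-(N : ℤ)) N, ‖W j σ‖ :=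
      Finset.single_le_sum (f := fun j => ‖W j σ‖) (fun j _ => norm_nonneg _) hmem
    linarith
  have hfin := measure_loud_lt_top hW N hδ
  have hsub : Iic s₀ ⊆ {σ : ℝ | 1 / (64 * K) ≤ ∑ k ∈ Finset.Icc (-(N : ℤ)) N, ‖W k σ‖} :=
    fun σ hσ => hband σ hσ
  have hinf : volume (Iic s₀) = ⊤ := Real.volume_Iic
  have := measure_mono (μ := volume) hsub
  rw [hinf, top_le_iff] at this
  exact (lt_top_iff_ne_top.1 hfin) this

end WakeRatchetQuietPast

end Summit.NavierStokesRegularity.NavierStokesRegularity.Theorems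

end
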